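import Mathlib
import HarnessLib
import Summits.Ventures.LatticeQCDFlow.Scaling.MDTunnellingLaw
import Summits.Ventures.LatticeQCDFlow.Scaling.TransformedTunnelling
import Summits.Ventures.LatticeQCDFlow.Exactness.TransformedHMC

/-!
# LatticeQCDFlow / Scaling — TUNNELLING LAWS VI: the molecular-dynamics law for FIELD-TRANSFORMED HMC (FTHMC / trivializing-map HMC as the code runs it)

HONEST FRAMING: exact (Metropolis-corrected) sampling algorithms for lattice gauge theory;
figures of merit are autocorrelation/cost numbers at stated couplings and volumes; no
continuum-physics claim.

THEORY-2.md §3.3 / §5 (v4.5, theory seat GEN-26, item 118, MD level).  The configuration chain of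
field-transformed HMC is, verbatim, the kernel of `Exactness/MomentumRefresh.thmc_config_exact`:
`K_F = conjKernel (refreshUpdate (involMH Φ _ H̃) μP) F` — refresh `π`, integrate the MODIFIED
Hamiltonian `H̃(v, π) = (S (F v) - log J v) + T π` on the latent variables with ANY volume-preserving
steps, accept/reject, forget `π`, report `U = F V`.  The tree proves it exact for `e^{-S}vol`.  This
file is its tunnelling law:

* §1 `map_boltz_modified`, `map_prodMap_boltz_modified`, `boltz_modified_preimage_prodMap` — the
  change of variables: `F_* (e^{-S̃}vol) = e^{-S}vol` and `(F × id)_* (e^{-H̃}(vol ⊗ volP)) =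
  e^{-H}(vol ⊗ volP)`, so latent phase-space sets of the form `(F × id)⁻¹ A` have modified-Boltzmann
  mass `B̃((F × id)⁻¹ A) = B(A)`.
* §2 **FTHMC TUNNELLING LAW** `fthmc_chargeNe_le_sum`: for every measurable real charge `Q` of the
  PHYSICAL field, measurable separating sets `C k` of the LATENT steps for `Q ∘ F`
  (`Q (F (step k z).1) ≠ Q (F z.1) → z ∈ C k`) and every `h`:
  `(e^{-S}vol ⊗ₘ K_F){Q ≠ Q'} ≤ Z_T⁻¹ · Σ_{k<n} (e^{h}·B̃(C k) + B̃{ΔH̃_k > h})`, `B̃ = e^{-H̃}(vol ⊗ volP)`,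
  `ΔH̃_k` the energy violation of the FTHMC integrator at node `k` (the quantity the code monitors).
  Proof: the reported pair law is the latent pair law under `F × F`
  (`Transformed.compProd_map_conjKernel_ne`), `e^{-S}vol = F_*(e^{-S̃}vol)`, and the tree's
  `MD.hmc_chargeNe_le_sum` for the latent chain with charge `Q ∘ F`.
* §3 `fthmc_chargeNe_le_sum_physical`: if the separating sets are preimages, `C k ⊆ (F × id)⁻¹ (A k)`,
  the collar term is a PHYSICAL Boltzmann mass: `… ≤ Z_T⁻¹ · Σ_{k<n} (e^{h}·B(A k) + B̃{ΔH̃_k > h})`.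
  With `Transformed.apply_mem_cthickening_of_path`: for a latent drift node moving the configuration
  along a path of sup-length `ℓ_k(z)` and a `Λ`-Lipschitz `F`, `A k = {(u, π) | u ∈ cthickening (Λ ℓ_k) D}`
  — the plain-HMC momentum collar (`Scaling/MDFluxTunnelling.lean`) with its radius multiplied by `Λ`.

Reading (markdown, THEORY-2.md §3.3 (x)): per unit trajectory, FTHMC changes the topological sector at
most `Λ ×` (collar mass is at most linear in the radius for the one-plaquette cut tails) as often as the
bound for HMC at the same step size allows, plus its own energy-violation tails; `Λ ≤ e^{K}` for a flow
map with generator Lipschitz modulus `K` (`Scaling/FlowLipschitzBudget.lean`).  Everything here is NEW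
WORK of the cell over Mathlib and the tree (elementary); no printed theorem is claimed; no claim that any
`F` attains the bound.
-/

noncomputable section

namespace Summit.Ventures.LatticeQCDFlow.Theory2.Tunnelling.MD

open MeasureTheory ProbabilityTheory Set
open scoped ENNReal NNReal
open Summit.Ventures.LatticeQCDFlow.Exactness
open Summit.Ventures.LatticeQCDFlow.Theory2.Tunnelling.Transformed

variable {Ω P : Type*} [MeasurableSpace Ω] [MeasurableSpace P]

/-! ## §1. The change of variables for Boltzmann laws -/

section ChangeOfVariables

variable {vol : Measure Ω} {F : Ω ≃ᵐ Ω} {J : Ω → ℝ}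

/-- `F_* (e^{-S̃}vol) = e^{-S}vol` for the modified action `S̃ = S ∘ F - log J` (`J > 0` the Jacobian of
`F`). [folklore] -/
theorem map_boltz_modified (hJ : ∀ v, 0 < J v) (hF : HasJacobian vol F fun v => ENNReal.ofReal (J v))
    {S : Ω → ℝ} (hS : Measurable S) :
    (boltz vol fun v => S (F v) - Real.log (J v)).map F = boltz vol S := by
  unfold boltz
  rw [withDensity_exp_neg_transformedAction hJ S]
  exact hF.map_withDensity (q := fun u => ENNReal.ofReal (Real.exp (-S u))) (measurable_expNeg hS)

variable {volP : Measure P} [SFinite vol] [SFinite volP]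

/-- Phase space: `(F × id)_* (e^{-H̃}(vol ⊗ volP)) = e^{-H}(vol ⊗ volP)`,
`H̃ (v, π) = (S (F v) - log J v) + T π`, `H (u, π) = S u + T π`. [folklore] -/
theorem map_prodMap_boltz_modified (hJ : ∀ v, 0 < J v)
    (hF : HasJacobian vol F fun v => ENNReal.ofReal (J v)) {S : Ω → ℝ} (hS : Measurable S)
    {T : P → ℝ} (hT : Measurable T) :
    (boltz (vol.prod volP) fun z : Ω × P => (S (F z.1) - Real.log (J z.1)) + T z.2).map
        (Prod.map F id) =
      boltz (vol.prod volP) fun z : Ω × P => S z.1 + T z.2 := by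
  have hF' : HasJacobian (vol.prod volP) (Prod.map (⇑F) id) fun z => ENNReal.ofReal (J z.1) :=
    hF.prodMap_id volP
  have hH : Measurable fun z : Ω × P => S z.1 + T z.2 :=
    (hS.comp measurable_fst).add (hT.comp measurable_snd)
  simp only [boltz]
  rw [← hF'.map_withDensity (q := fun z : Ω × P => ENNReal.ofReal (Real.exp (-(S z.1 + T z.2))))
    (measurable_expNeg hH)]
  congr 1
  refine withDensity_congr_ae (Filter.Eventually.of_forall fun z => ?_)
  show ENNReal.ofReal (Real.exp (-((S (F z.1) - Real.log (J z.1)) + T z.2))) =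
    ENNReal.ofReal (Real.exp (-(S (F z.1) + T z.2))) * ENNReal.ofReal (J z.1)
  have e : Real.exp (-((S (F z.1) - Real.log (J z.1)) + T z.2)) =
      Real.exp (-(S (F z.1) + T z.2)) * J z.1 := by
    rw [show -((S (F z.1) - Real.log (J z.1)) + T z.2) = -(S (F z.1) + T z.2) + Real.log (J z.1) by
      ring, Real.exp_add, Real.exp_log (hJ z.1)]
  rw [e, ENNReal.ofReal_mul (Real.exp_pos _).le]

/-- **Latent preimage collars have physical mass**: `B̃((F × id)⁻¹ A) = B(A)` for measurable `A`.
[folklore] -/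
theorem boltz_modified_preimage_prodMap (hJ : ∀ v, 0 < J v)
    (hF : HasJacobian vol F fun v => ENNReal.ofReal (J v)) {S : Ω → ℝ} (hS : Measurable S)
    {T : P → ℝ} (hT : Measurable T) {A : Set (Ω × P)} (hA : MeasurableSet A) :
    boltz (vol.prod volP) (fun z : Ω × P => (S (F z.1) - Real.log (J z.1)) + T z.2)
        (Prod.map F id ⁻¹' A) =
      boltz (vol.prod volP) (fun z : Ω × P => S z.1 + T z.2) A := by
  rw [← map_prodMap_boltz_modified hJ hF hS hT,
    Measure.map_apply (F.measurable.prodMap measurable_id) hA]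

end ChangeOfVariables

/-! ## §2. The FTHMC tunnelling law -/

section FTHMC

/-- **FTHMC TUNNELLING LAW (abstract).**  Target `e^{-S}vol`; field transformation `F` with positive
measurable Jacobian `J`; kinetic term `T` with `0 < Z_T < ∞`, momentum law `Z_T⁻¹ e^{-T}volP`; latent
proposal `Φ = flip ∘ (nodes step n)` for `vol ⊗ volP`-preserving measurable steps (an integrator for
`H̃ = (S ∘ F - log J) + T`, of any accuracy) and a measurable `flip` that does not touch the
configuration; the configuration kernel is that of `thmc_config_exact`, verbatim.  If `C k` are
measurable sets the pre-step latent phase point must lie in whenever step `k` changes the physical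
charge `Q ∘ F`, then for every `h : ℝ`:
`(e^{-S}vol ⊗ₘ K_F){Q ≠ Q'} ≤ Z_T⁻¹ · Σ_{k<n} (e^{h}·B̃(C k) + B̃{z | h < H̃ (nodes step k z) - H̃ z})`,
`B̃ = e^{-H̃}(vol ⊗ volP)`. [folklore] -/
theorem fthmc_chargeNe_le_sum (vol : Measure Ω) (volP : Measure P) [SFinite vol] [SFinite volP]
    {F : Ω ≃ᵐ Ω} {J : Ω → ℝ} (hJ : ∀ v, 0 < J v) (hJm : Measurable J)
    (hF : HasJacobian vol F fun v => ENNReal.ofReal (J v))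
    {S : Ω → ℝ} (hS : Measurable S) {T : P → ℝ} (hT : Measurable T)
    {step : ℕ → Ω × P → Ω × P}
    (hstep : ∀ k, MeasurePreserving (step k) (vol.prod volP) (vol.prod volP))
    {flip : Ω × P → Ω × P} (hflip : ∀ z, (flip z).1 = z.1) (n : ℕ)
    {Φ : Ω × P → Ω × P} (hΦ : Measurable Φ) (hΦeq : ∀ z, Φ z = flip (nodes step n z))
    {Q : Ω → ℝ} (hQ : Measurable Q) (C : ℕ → Set (Ω × P)) (hC : ∀ k, MeasurableSet (C k))
    (hsep : ∀ k z, Q (F (step k z).1) ≠ Q (F z.1) → z ∈ C k)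
    (hZ0 : volP.withDensity (fun π => ENNReal.ofReal (Real.exp (-T π))) Set.univ ≠ 0)
    (hZtop : volP.withDensity (fun π => ENNReal.ofReal (Real.exp (-T π))) Set.univ ≠ ∞) (h : ℝ) :
    (boltz vol S ⊗ₘ
        conjKernel
          (refreshUpdate
            (involMH Φ hΦ fun z : Ω × P => (S (F z.1) - Real.log (J z.1)) + T z.2)
            ((volP.withDensity (fun π => ENNReal.ofReal (Real.exp (-T π))) Set.univ)⁻¹ •
              volP.withDensity fun π => ENNReal.ofReal (Real.exp (-T π))))
          F)
      {q : Ω × Ω | Q q.1 ≠ Q q.2} ≤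
      (volP.withDensity (fun π => ENNReal.ofReal (Real.exp (-T π))) Set.univ)⁻¹ *
        ∑ k ∈ Finset.range n,
          (ENNReal.ofReal (Real.exp h) *
              boltz (vol.prod volP) (fun z : Ω × P => (S (F z.1) - Real.log (J z.1)) + T z.2) (C k) +
            boltz (vol.prod volP) (fun z : Ω × P => (S (F z.1) - Real.log (J z.1)) + T z.2)
              {z | h < ((S (F (nodes step k z).1) - Real.log (J (nodes step k z).1)) +
                  T (nodes step k z).2) - ((S (F z.1) - Real.log (J z.1)) + T z.2)}) := by
  set νT := volP.withDensity fun π => ENNReal.ofReal (Real.exp (-T π)) with hνT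
  set Z := νT Set.univ with hZ
  haveI : IsProbabilityMeasure (Z⁻¹ • νT) :=
    ⟨by rw [Measure.smul_apply, smul_eq_mul, ENNReal.inv_mul_cancel hZ0 hZtop]⟩
  have hSt : Measurable fun v => S (F v) - Real.log (J v) :=
    (hS.comp F.measurable).sub (Real.measurable_log.comp hJm)
  haveI : Fact (Measurable fun z : Ω × P => (S (F z.1) - Real.log (J z.1)) + T z.2) :=
    ⟨(hSt.comp measurable_fst).add (hT.comp measurable_snd)⟩
  -- the physical target is the image of the latent one
  rw [← map_boltz_modified hJ hF hS]
  -- the reported pair law is the latent pair law under `F × F`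
  rw [compProd_map_conjKernel_ne _ _ F hQ]
  -- the latent HMC tunnelling law for the charge `Q ∘ F`
  exact hmc_chargeNe_le_sum vol volP (S := fun v => S (F v) - Real.log (J v)) hSt hT hstep hflip n
    hΦ hΦeq (hQ.comp F.measurable) C hC hsep hZ0 hZtop h

/-- **FTHMC TUNNELLING LAW, physical collars.**  As above; if moreover each separating set is the
preimage of a measurable PHYSICAL phase-space set, `C k ⊆ (F × id)⁻¹ (A k)`, the collar terms are
physical Boltzmann masses:
`(e^{-S}vol ⊗ₘ K_F){Q ≠ Q'} ≤ Z_T⁻¹ · Σ_{k<n} (e^{h}·B(A k) + B̃{ΔH̃_k > h})`, `B = e^{-(S+T)}(vol ⊗ volP)`.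
For a `Λ`-Lipschitz `F` and a latent drift node of sup-length `ℓ`, `A k` is the collar of radius `Λ ℓ`
about the defect set (`Transformed.apply_mem_cthickening_of_path`). [folklore] -/
theorem fthmc_chargeNe_le_sum_physical (vol : Measure Ω) (volP : Measure P) [SFinite vol]
    [SFinite volP] {F : Ω ≃ᵐ Ω} {J : Ω → ℝ} (hJ : ∀ v, 0 < J v) (hJm : Measurable J)
    (hF : HasJacobian vol F fun v => ENNReal.ofReal (J v))
    {S : Ω → ℝ} (hS : Measurable S) {T : P → ℝ} (hT : Measurable T)
    {step : ℕ → Ω × P → Ω × P}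
    (hstep : ∀ k, MeasurePreserving (step k) (vol.prod volP) (vol.prod volP))
    {flip : Ω × P → Ω × P} (hflip : ∀ z, (flip z).1 = z.1) (n : ℕ)
    {Φ : Ω × P → Ω × P} (hΦ : Measurable Φ) (hΦeq : ∀ z, Φ z = flip (nodes step n z))
    {Q : Ω → ℝ} (hQ : Measurable Q) (C : ℕ → Set (Ω × P)) (hC : ∀ k, MeasurableSet (C k))
    (hsep : ∀ k z, Q (F (step k z).1) ≠ Q (F z.1) → z ∈ C k)
    (A : ℕ → Set (Ω × P)) (hA : ∀ k, MeasurableSet (A k)) (hCA : ∀ k, C k ⊆ Prod.map F id ⁻¹' A k)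
    (hZ0 : volP.withDensity (fun π => ENNReal.ofReal (Real.exp (-T π))) Set.univ ≠ 0)
    (hZtop : volP.withDensity (fun π => ENNReal.ofReal (Real.exp (-T π))) Set.univ ≠ ∞) (h : ℝ) :
    (boltz vol S ⊗ₘ
        conjKernel
          (refreshUpdate
            (involMH Φ hΦ fun z : Ω × P => (S (F z.1) - Real.log (J z.1)) + T z.2)
            ((volP.withDensity (fun π => ENNReal.ofReal (Real.exp (-T π))) Set.univ)⁻¹ •
              volP.withDensity fun π => ENNReal.ofReal (Real.exp (-T π))))
          F)
      {q : Ω × Ω | Q q.1 ≠ Q q.2} ≤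
      (volP.withDensity (fun π => ENNReal.ofReal (Real.exp (-T π))) Set.univ)⁻¹ *
        ∑ k ∈ Finset.range n,
          (ENNReal.ofReal (Real.exp h) *
              boltz (vol.prod volP) (fun z : Ω × P => S z.1 + T z.2) (A k) +
            boltz (vol.prod volP) (fun z : Ω × P => (S (F z.1) - Real.log (J z.1)) + T z.2)
              {z | h < ((S (F (nodes step k z).1) - Real.log (J (nodes step k z).1)) +
                  T (nodes step k z).2) - ((S (F z.1) - Real.log (J z.1)) + T z.2)}) := by
  have hk : ∀ k, boltz (vol.prod volP) (fun z : Ω × P => (S (F z.1) - Real.log (J z.1)) + T z.2) (C k) ≤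
      boltz (vol.prod volP) (fun z : Ω × P => S z.1 + T z.2) (A k) := fun k => by
    rw [← boltz_modified_preimage_prodMap hJ hF hS hT (hA k)]
    exact measure_mono (hCA k)
  exact (fthmc_chargeNe_le_sum vol volP hJ hJm hF hS hT hstep hflip n hΦ hΦeq hQ C hC hsep hZ0
    hZtop h).trans (mul_le_mul_right (Finset.sum_le_sum fun k _ =>
      add_le_add (mul_le_mul_right (hk k) _) le_rfl) _)

end FTHMC

end Summit.Ventures.LatticeQCDFlow.Theory2.Tunnelling.MD

end
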